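import Mathlib
import Summits.NavierStokesRegularity.NavierStokesRegularity.Theorems.ThreadingFluxHorizonTowerFiniteTowerThirdShell
import HarnessLib

/-!
# Crux `PoloidalLiouville` (stmt-NavierStokesRegularity-1222), crux idea «horizon-threading-tower» (ns-idea-15):
# FINITE TOWERS AT ORDER ONE — THM C′: TOP PAIR OF OPPOSITE PARITY, ISOLATED SAME-PARITY COMPANION

Support file (`--supports stmt-NavierStokesRegularity-1222`, helper; cell `ns-wall-extremal`, width hand ns-wall-eng-3 g5; 0 kit).

The mirror image of THM C (`finiteTower_zonal_of_oppositeParity`, ns-wall-eng-3 g4, `…FiniteTowerThirdShell`): there the two largest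
degrees `D′ < D` have the SAME parity and the largest degree `a` of the other parity is automatically isolated against `D`.  Here the
two largest degrees have OPPOSITE parity (then `gcd(D, D′)` is odd, `≥ 3` in the interesting case, e.g. the top pair `(3, 6)` of
`{1, 2, 3, 6}` — the smallest tower not decided by THM A–H), `a` is the largest degree `≠ D` of the parity OF `D`, and the pair `(a, D)` is
isolated in its (even-sum) parity class as soon as no two shells of the parity of `D′` have degree sum `≥ a + D` (automatic when
`2D′ ≤ a + D + 1`).  Then both `f_{D′}^D ∝ g^{D′}` and `f_a^D ∝ g^a` hold for the null-cone charts, and `gcd(D, D′, a) = 1` makes every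
root multiplicity of the top chart `g` divisible by `D`: `g = β q^D`, `deg q ≤ 2`, the top shell is zonal about a real axis
(`Zonal.exists_real_axis_of_chartT_eq_pow`) and THM A descends.

* ★★ `finiteTower_zonal_of_oppositeParityTop` (THM C′): `D′ ≢ D (mod 2)`, `a ≡ D (mod 2)` the largest such degree below `D`,
  no two shells of the parity of `D′` with degree sum `≥ a + D`, `H_D, H_{D′}, H_a ≢ 0`, `Nat.Coprime D (Nat.gcd D′ a)` ⇒ coaxially zonal.
  Covers `{1,2,3,6}` (`a = 2`, odd sums `≤ 4 < 8`), `{2,4,5,10}` (`a = 4`, one odd shell), `{1,2,3,4,9,12}` (`a = 4`, odd sums `≤ 12 < 16`);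
  NOT `{1,3,5,10}` (no even shell below `10`).

HONEST LABEL: special cases of the crux-idea conjecture `HorizonTowerZonality` (order one; side condition on three shells); general
towers, `PoloidalLiouville` (1222) OPEN; W1 movement 0; NS regularity NOT proved.  [folklore]
-/

-- the summit and its single sub-problem share the name (CONVENTIONS §1)
set_option linter.dupNamespace false

noncomputable section

open MvPolynomial Complex
open scoped Polynomial RealInnerProductSpace
open Literature.Analysis.FluidPDE (cross)

namespace Summit.NavierStokesRegularity.NavierStokesRegularity.Theorems.PoloidalLiouville.HorizonTower

section OppositeTop

variable (K : Finset ℕ) (H : ℕ → E3 → ℝ)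

/-- **THM C′, polynomial level.**  `D = max K`, `D′` the second largest degree with `D′ ≢ D (mod 2)`, `a ∈ K` the largest degree
`≠ D` of the parity of `D`, no two degrees of the parity of `D′` with sum `≥ a + D`; `P_D, P_{D′}, P_a ≠ 0`;
`Nat.Coprime D (Nat.gcd D′ a)` ⇒ the top shell is annihilated by the rotation derivative about some real axis. [folklore] -/
theorem finiteTower_exists_axis_of_oppositeParityTop (hK : ∀ l ∈ K, 1 ≤ l) (hH : ∀ l ∈ K, ContDiff ℝ (⊤ : ℕ∞) (H l))
    (hhom : ∀ l ∈ K, ∀ (c : ℝ) (y : E3), H l (c • y) = c ^ l * H l y)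
    (hharm : ∀ l ∈ K, ∀ y, Laplacian.laplacian (H l) y = 0)
    (hL1 : ∀ x : E3, x ≠ 0 → horizonL1 (fun z => ∑ l ∈ K, horizonProfile l (H l) 0 z) 0 x = 0)
    (P : ℕ → MvPolynomial (Fin 3) ℝ)
    (hP : ∀ l ∈ K, (P l).IsHomogeneous l ∧ Zonal.lapP (P l) = 0 ∧ ∀ y, H l y = Zonal.evalE (P l) y)
    {D D' a : ℕ} (hD : D ∈ K) (hD' : D' ∈ K) (hlt : D' < D) (hmax : ∀ l ∈ K, l ≤ D) (hsec : ∀ l ∈ K, l ≠ D → l ≤ D')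
    (hpar : D' % 2 ≠ D % 2) (haK : a ∈ K) (haD : a ≠ D) (hapar : a % 2 = D % 2)
    (hamax : ∀ l ∈ K, l ≠ D → l % 2 = D % 2 → l ≤ a)
    (hiso' : ∀ j ∈ K, ∀ k ∈ K, j ≠ k → j % 2 ≠ D % 2 → k % 2 ≠ D % 2 → j + k < a + D)
    (hcop : Nat.Coprime D (Nat.gcd D' a)) (hPD : P D ≠ 0) (hPD' : P D' ≠ 0) (hPa : P a ≠ 0) :
    ∃ n : Fin 3 → ℝ, n ≠ 0 ∧ Zonal.detP (C (n 0) * X 0 + C (n 1) * X 1 + C (n 2) * X 2) (P D) = 0 := by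
  have halt : a < D := lt_of_le_of_ne (hmax a haK) haD
  -- `(a, D)` is isolated inside its parity class
  have hiso := finiteTower_chartT_detP_eq_zero_of_class K H hK hH hhom hharm hL1 P (fun l hl => (hP l hl).2.2) haK hD haD (by
    intro j hj k hk hjk hsum hcls h1 h2
    exfalso
    have hjD := hmax j hj
    have hkD := hmax k hk
    rcases eq_or_ne k D with rfl | hkne
    · -- `(j, D)`: `j ≥ a`, `j` of the parity of `a` ⇒ `j = a`
      have hja : j % 2 = k % 2 := by omega
      have := hamax j hj hjk hja
      exact h1 ⟨by omega, rfl⟩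
    · rcases eq_or_ne j D with rfl | hjne
      · have hka : k % 2 = j % 2 := by omega
        have := hamax k hk hkne hka
        exact h2 ⟨rfl, by omega⟩
      · -- both below `D`: both `≤ D′ < D`; a degree of the parity of `D` would be `≤ a`, forcing the other one above `D′`
        have hk' := hsec k hk hkne
        have hj' := hsec j hj hjne
        have hjp : j % 2 ≠ D % 2 := fun h => by have := hamax j hj hjne h; omega
        have hkp : k % 2 ≠ D % 2 := fun h => by have := hamax k hk hkne h; omega
        have := hiso' j hj k hk hjk hjp hkp
        omega)
  -- charts
  set fa : ℂ[X] := Zonal.chartT (map (algebraMap ℝ ℂ) (P a)) with hfa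
  set fD' : ℂ[X] := Zonal.chartT (map (algebraMap ℝ ℂ) (P D')) with hfD'
  set g : ℂ[X] := Zonal.chartT (map (algebraMap ℝ ℂ) (P D)) with hg
  have hfa0 : fa ≠ 0 := fun h => hPa (Zonal.eq_zero_of_chartT_map_eq_zero (hP a haK).1 (hP a haK).2.1 h)
  have hfD'0 : fD' ≠ 0 := fun h => hPD' (Zonal.eq_zero_of_chartT_map_eq_zero (hP D' hD').1 (hP D' hD').2.1 h)
  have hg0 : g ≠ 0 := fun h => hPD (Zonal.eq_zero_of_chartT_map_eq_zero (hP D hD).1 (hP D hD).2.1 h)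
  -- the weighted Wronskian laws `a·fa·g′ = D·g·fa′` and `D′·fD′·g′ = D·g·fD′′`
  have hWa : (a : ℂ[X]) * fa * Polynomial.derivative g = (D : ℂ[X]) * g * Polynomial.derivative fa := by
    have h := Zonal.chartT_detP (((hP a haK).1).map (algebraMap ℝ ℂ)) (((hP D hD).1).map (algebraMap ℝ ℂ))
    rw [← Zonal.map_detP, hiso, mul_zero] at h
    exact sub_eq_zero.mp h.symm
  have hWD' := finiteTower_top_wronskian K H hK hH hhom hharm hL1 P (fun l hl => ⟨(hP l hl).1, (hP l hl).2.2⟩) hD hD' hlt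
    hmax hsec
  obtain ⟨c₁, hc₁⟩ := Zonal.exists_C_mul_of_wronskian_eq_zero (pow_ne_zero _ hg0)
    (Zonal.wronskian_pow_pow_eq_zero (hK a haK) (hK D hD) hWa)
  obtain ⟨c₂, hc₂⟩ := Zonal.exists_C_mul_of_wronskian_eq_zero (pow_ne_zero _ hg0)
    (Zonal.wronskian_pow_pow_eq_zero (hK D' hD') (hK D hD) hWD')
  obtain ⟨q, hqm, hgq, hdeg⟩ := Zonal.exists_monic_eq_C_mul_pow_of_two_rel (hK D hD) hfD'0 hfa0 hc₂ hc₁ hcop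
  have hq2 : q.natDegree ≤ 2 := by
    have h1 : g.natDegree ≤ 2 * D := Zonal.natDegree_chartT_le (((hP D hD).1).map (algebraMap ℝ ℂ))
    have h2 : D * q.natDegree ≤ D * 2 := by rw [hdeg, mul_comm]; exact h1
    exact Nat.le_of_mul_le_mul_left h2 (hK D hD)
  exact Zonal.exists_real_axis_of_chartT_eq_pow (hP D hD).1 (hK D hD) (hP D hD).2.1 hqm.ne_zero hq2 hgq

/-- ★★ **THM C′ — OPPOSITE-PARITY TOP PAIR.**  A finite scale-free tower of horizon profiles passing order one whose two largest
degrees `D′ < D` have OPPOSITE parity, whose largest degree `a ≠ D` of the parity of `D` carries a non-zero shell (as do `D`, `D′`),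
with no two shells of the parity of `D′` of degree sum `≥ a + D`, and with `gcd(D, D′, a) = 1`, is COAXIALLY ZONAL. [folklore] -/
theorem finiteTower_zonal_of_oppositeParityTop (hK : ∀ l ∈ K, 1 ≤ l) (hH : ∀ l ∈ K, ContDiff ℝ (⊤ : ℕ∞) (H l))
    (hhom : ∀ l ∈ K, ∀ (c : ℝ) (y : E3), H l (c • y) = c ^ l * H l y)
    (hharm : ∀ l ∈ K, ∀ y, Laplacian.laplacian (H l) y = 0)
    (hL1 : ∀ x : E3, x ≠ 0 → horizonL1 (fun z => ∑ l ∈ K, horizonProfile l (H l) 0 z) 0 x = 0)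
    {D D' a : ℕ} (hD : D ∈ K) (hD' : D' ∈ K) (hlt : D' < D) (hmax : ∀ l ∈ K, l ≤ D) (hsec : ∀ l ∈ K, l ≠ D → l ≤ D')
    (hpar : D' % 2 ≠ D % 2) (haK : a ∈ K) (haD : a ≠ D) (hapar : a % 2 = D % 2)
    (hamax : ∀ l ∈ K, l ≠ D → l % 2 = D % 2 → l ≤ a)
    (hiso' : ∀ j ∈ K, ∀ k ∈ K, j ≠ k → j % 2 ≠ D % 2 → k % 2 ≠ D % 2 → j + k < a + D)
    (hcop : Nat.Coprime D (Nat.gcd D' a)) (hD0 : ∃ y, H D y ≠ 0) (hD'0 : ∃ y, H D' y ≠ 0) (ha0 : ∃ y, H a y ≠ 0) :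
    ∃ b : E3, b ≠ 0 ∧ ∀ l ∈ K, ∀ y : E3, ⟪cross b y, gradient (H l) y⟫ = 0 := by
  obtain ⟨P, hP⟩ := finiteTower_exists_polys K H hH hhom hharm
  have hne : ∀ {l}, l ∈ K → (∃ y, H l y ≠ 0) → P l ≠ 0 := by
    intro l hl ⟨y, hy⟩ h
    apply hy
    rw [(hP l hl).2.2 y, h]
    simp [Zonal.evalE]
  obtain ⟨n, hn, htop⟩ := finiteTower_exists_axis_of_oppositeParityTop K H hK hH hhom hharm hL1 P hP hD hD' hlt hmax hsec hpar
    haK haD hapar hamax hiso' hcop (hne hD hD0) (hne hD' hD'0) (hne haK ha0)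
  have hna : (WithLp.toLp 2 n : E3) ≠ 0 := by
    intro h
    apply hn
    funext i
    have := congrArg (fun v : E3 => v i) h
    simpa using this
  refine ⟨WithLp.toLp 2 n, hna, fun l hl y => ?_⟩
  have h := finiteTower_detP_lin_eq_zero_of_top K H hK hH hhom hharm hL1 P hP hD hmax (hne hD hD0) hn htop l hl
  rw [Zonal.detP_lin_eq_zero_iff] at h
  have := h y
  rwa [← show H l = Zonal.evalE (P l) from funext (hP l hl).2.2] at this

/-- THM C′ with the zonal functional forms. [folklore] -/
theorem finiteTower_zonalForm_of_oppositeParityTop (hK : ∀ l ∈ K, 1 ≤ l) (hH : ∀ l ∈ K, ContDiff ℝ (⊤ : ℕ∞) (H l))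
    (hhom : ∀ l ∈ K, ∀ (c : ℝ) (y : E3), H l (c • y) = c ^ l * H l y)
    (hharm : ∀ l ∈ K, ∀ y, Laplacian.laplacian (H l) y = 0)
    (hL1 : ∀ x : E3, x ≠ 0 → horizonL1 (fun z => ∑ l ∈ K, horizonProfile l (H l) 0 z) 0 x = 0)
    {D D' a : ℕ} (hD : D ∈ K) (hD' : D' ∈ K) (hlt : D' < D) (hmax : ∀ l ∈ K, l ≤ D) (hsec : ∀ l ∈ K, l ≠ D → l ≤ D')
    (hpar : D' % 2 ≠ D % 2) (haK : a ∈ K) (haD : a ≠ D) (hapar : a % 2 = D % 2)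
    (hamax : ∀ l ∈ K, l ≠ D → l % 2 = D % 2 → l ≤ a)
    (hiso' : ∀ j ∈ K, ∀ k ∈ K, j ≠ k → j % 2 ≠ D % 2 → k % 2 ≠ D % 2 → j + k < a + D)
    (hcop : Nat.Coprime D (Nat.gcd D' a)) (hD0 : ∃ y, H D y ≠ 0) (hD'0 : ∃ y, H D' y ≠ 0) (ha0 : ∃ y, H a y ≠ 0) :
    ∃ b : E3, b ≠ 0 ∧ ∀ l ∈ K, ∃ g : ℝ → ℝ, ∀ y : E3, y ≠ 0 → H l y = ‖y‖ ^ l * g (⟪b, y⟫ / ‖y‖) := by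
  obtain ⟨b, hb, hrot⟩ := finiteTower_zonal_of_oppositeParityTop K H hK hH hhom hharm hL1 hD hD' hlt hmax hsec hpar haK haD hapar
    hamax hiso' hcop hD0 hD'0 ha0
  exact ⟨b, hb, fun l hl => exists_zonalForm_of_inner_cross_gradient_eq_zero (l := l) hb ((hH l hl).differentiable (by simp))
    (fun c y _ => hhom l hl c y) (hrot l hl)⟩

end OppositeTop

end Summit.NavierStokesRegularity.NavierStokesRegularity.Theorems.PoloidalLiouville.HorizonTower

end
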